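import Summits.BirchSwinnertonDyer.BirchSwinnertonDyer.Theorems.PrintX11aLowerHalfOfChildrenMuFive
import HarnessLib

/-!
# Crux `X11aLowerHalf` (item stmt-BirchSwinnertonDyer-19064): its `p ≥ 5` RESTRICTION keyed on the REGISTERED children of line «birth» r16
# (width seat bsd-line-er5-p2 = -w3, gen 11; `--supports stmt-BirchSwinnertonDyer-19064` helper; no registry verb; the lead decides)

HONEST FRAMING.  Composition theorems only; no definition, no named fact minted, no `sorry`.  Every theorem is CONDITIONAL on its
displayed binders and closes nothing by itself; the residual statements of the line (`hμ5` = Greenberg's analytic `μ = 0` on the deep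
X11a pairs at `p ≥ 5`; `hMC3` = Mazur's cyclotomic main conjecture at the très-ramifié deep X11a pairs at `3`) stay OPEN and DISPLAYED.
No summit statement is proved; BSD is proved for no curve and no class.

WHY THIS FILE.  Line «birth» r16 of crux L (skeleton 06fb1f5303c8e9dd, registered 2026-08-28T17:48:44Z) has FIVE children:
`stub_nineFactsOddGS` (the shared nine, U3's text) ∣ `stub_chainFactsLower` (EIGHT chain facts) ∣ `stub_threePartnerFactsLower` (three partner
facts, consumed at the finite-flat `p = 3` pairs only) ∣ `stub_muAnDeepFive` (`hμ5`, OPEN) ∣ `stub_mazurMCAtTresRamifieThree` (`hMC3`, OPEN),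
composed by `Birth.x11aLowerHalf_erratumRoadFive_of_children_r16` (p652061).  bsd-stepL's crux 19715 `EulerHalfNotRamNoInertSetAtFive` binds
the route item `X11aLowerHalf` (ALL odd `p`) but APPLIES it only at the pair's own prime `p ≥ 5` (LEAD er5-p1 g4, 2026-08-28T17:57:50Z:
`…_of_sixItems_of_lowerX11aFive`, binder `∀ Wd p, ClassX11a Wd p → 5 ≤ p → MissingLowerBoundAt Wd p`).  The tree's existing `p ≥ 5` glue
`NonSurjChain.x11aLowerHalf_five_of_forall_muAnZeroAt_of_facts` (line r1 era) is keyed on SEVENTEEN fact binders that are NOT r16's children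
(non-`_odd` EPW 3.1.1 ∕ Thm 1 ∕ 5.1.3, Kato's non-contragredient §17.13 inputs, Greenberg 1.5, Wuthrich Cor. 18, `greenberg_stevens` without the
`p ≠ 2` guard).  This file keys the SAME restriction on r16's registered texts, byte for byte:
* §1 `Birth.lowerX11aFive_of_children_r16_three h9 h8L hμ5` — **the `p ≥ 5` restriction of crux L from THREE of r16's five children** (the
  shared nine, the eight chain facts, the certificate child); body = the `p ≥ 5` branch of p652061's `x11aLowerHalf_of_threeDeep_of_muAnDeepFive`
  verbatim.  So 19715's cone meets 19064 in exactly {`stub_nineFactsOddGS`, `stub_chainFactsLower`, `stub_muAnDeepFive`}: the two `p = 3`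
  children are provably outside it (the kernel says so: they are not binders here);
* §2 `Birth.x11aLowerHalf_of_lowerX11aFive_of_threeDeep` — the fact-free split of crux L BY NAME into its `p ≥ 5` restriction and the lower half at
  the deep `p = 3` pairs (unit pairs free, `x11a_missingLowerBoundAt_of_shaAnUnit`; an X11a prime is odd, so `p = 3 ∨ 5 ≤ p`), + the
  `ErratumRoadFive` spelling;
* §3 `Birth.x11aLowerHalf_of_lowerX11aFive_of_children_r16` — crux L BY NAME ⟸ its `p ≥ 5` restriction + r16's nine ∕ chain-eight ∕ three ∕ `hMC3`
  (the `p = 3` road `ThreePartner.lowerThreeDeep_of_partnerFF_of_mazurTR_of_facts` of p646859 consumes all nine of `h9`, conjuncts 7–8 of `h8L`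
  (Kato–Wuthrich A32, GZK), the three partner facts and `hMC3`), + the `ErratumRoadFive` spelling — the composition if a `p ≥ 5` alias item of
  19064 is ever filed (er5-p1 g4's option; the planners' call, not this seat's).
* §4 the same two theorems keyed on the lead's CANDIDATE r17 (x11a-p1 g7, p656106, announced 2026-08-28T18:08:35Z: the `p ≥ 5` child in
  MAZUR currency `stub_mazurMCAtDeepFive`, chain facts cut to the two-fact child `stub_katoGZKFactsLower`): `lowerX11aFive_of_children_r17_three
  h9 h2L hMC5` (through p646859's five-fact door; minimal display `lowerX11aFive_of_mazurMCAtDeepFive_of_fiveFacts` = ONE research statement +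
  modularity, Stein–Wuthrich ×2, GZK, Greenberg–Stevens) and `x11aLowerHalf_of_lowerX11aFive_of_children_r17 h5 h9 h2L hQ3 hMC3` (+ ER5 spelling) —
  so the boundary theorem survives the reshape whichever of r16 ∕ r17 is of record.
p652061's `x11aLowerHalf_of_children_r16 h9 h8L hQ3 hμ5 hMC3` = §3 applied to §1, and p656106's `x11aLowerHalf_of_children_r17` = §4's composition
applied to §4's restriction (same statements; not re-derived here, `dedup.landed`).
The monotone `lowerX11aFive_of_x11aLowerHalf` is er5-p1 g4's (their file (B)); not restated.

References: [GreenbergLNM1716] §1 Conj. 1.11 (p. 61); [Wan2015] Thm. 4; [EmertonPollackWeston2006] Thm. 1, 3.1.1, 5.1.3, Cor. 5.1.4;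
[YanZhu2024MainConjNonCM] Thm. 4.9; [Wuthrich2014] Thm. 3, Lemma 20; [Kato2004Asterisque] Thm. 12.4, §17.13; [SteinWuthrich2013] Thm. 6.1;
[Mazur1978] Cor. 4.1; [MazurTateTeitelbaum1986Invent] §I.14 (shape); [Fisher2012Hessian] Thm. 13.2; [Miller2011LMS] Def. 1.1; cell files
`Cruxes/X11aLowerHalf/Lines/birth.lean` (r16), `LEAD-g6-VERDICT.md`; bsd-stepL LEAD er5-p1 g4's
`Theorems/ErratumRoadFiveEulerHalfNotRamNoInertSetAtFiveOfSixItemsLowerX11aFive.lean` (mirror, §4–§5).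
-/

set_option autoImplicit false
set_option linter.dupNamespace false -- the directory name repeats the summit name (sibling precedent)

noncomputable section

open scoped Classical MatrixGroups ModularForm

open CongruenceSubgroup UpperHalfPlane WeierstrassCurve IsDedekindDomain Rat.HeightOneSpectrum
  Literature.NumberTheory.EllipticCurves
  Literature.NumberTheory.EllipticCurves.ModularForms
  Literature.NumberTheory.EllipticCurves.Rank1Residual
  Literature.NumberTheory.EllipticCurves.Rank1Residual.Typed
  Literature.NumberTheory.EllipticCurves.Wuthrich2014
  Literature.NumberTheory.EllipticCurves.SteinWuthrich2013
  Literature.NumberTheory.EllipticCurves.Greenberg1999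
  Literature.NumberTheory.EllipticCurves.Kato2004
  Literature.NumberTheory.EllipticCurves.GreenbergVatsal2000
  Literature.NumberTheory.EllipticCurves.EmertonPollackWeston2006
  Literature.NumberTheory.EllipticCurves.SkinnerUrban2014
  Literature.NumberTheory.EllipticCurves.BalakrishnanEtAl2019
  Literature.NumberTheory.GaloisRepresentations
  Literature.NumberTheory.Automorphic
  Summit.BirchSwinnertonDyer.Rank1Residual
  Summit.BirchSwinnertonDyer.Rank1Residual.X11a
  Summit.BirchSwinnertonDyer.BirchSwinnertonDyer.Theorems.OddChain

namespace Summit.BirchSwinnertonDyer.BirchSwinnertonDyer.Theorems.Birth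

/-! ### §1 The `p ≥ 5` restriction of crux L from THREE of r16's five children -/

/-- **The `p ≥ 5` restriction of crux `X11aLowerHalf` from THREE of line r16's five registered children**: the shared nine `h9`
(= `stub_nineFactsOddGS`, U3's text), the EIGHT chain facts `h8L` (= `stub_chainFactsLower`), and the both-images certificate `hμ5`
(= `stub_muAnDeepFive`: Greenberg's analytic `μ = 0`, `X11a.MuAnZeroAt`, at every deep X11a pair with `p ≥ 5`; OPEN class-wide) — binders
byte-equal to the registered texts.  Body = the `p ≥ 5` branch of p652061's `x11aLowerHalf_of_threeDeep_of_muAnDeepFive` verbatim: unit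
pairs free; X. Wan's rational Thm. 4 at an ordinary member (`h8L.2.2.1`, p ⩾ 5 in print) + EPW 3.1.1 ∕ Thm. 1 alg ∕ 5.1.3 (odd), Deligne–Serre,
Hida 3.26, then Kato–Wuthrich A32 with Wuthrich's big-image propagation (surjective image) or Kato §17.13 contra + 12.4 + Mazur 4.1
(non-surjective image).  The two `p = 3` children of r16 (`stub_threePartnerFactsLower`, `stub_mazurMCAtTresRamifieThree`) are NOT binders:
the `p = 3` residual of crux L is outside the cone of any consumer of this restriction (bsd-stepL crux 19715's `…_of_lowerX11aFive` closers).
The conclusion type is LEAD er5-p1's `h₃` binder verbatim.  CONDITIONAL; closes nothing; BSD is not proved.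
[cite: GreenbergLNM1716, §1 Conj. 1.11 (p. 61)] [cite: Wan2015, Thm. 4 (pp. 4–5)] [cite: EmertonPollackWeston2006, Thm. 3.1.1, Thm. 1, Thm. 5.1.3]
[cite: Kato2004Asterisque, Thm. 12.4 (p. 221), §17.13 (pp. 279–280)] [cite: Wuthrich2014, Thm. 3 (p. 382), Lemma 20]
[cite: Miller2011LMS, Def. 1.1 (arXiv:1010.2431 p. 3)] -/
theorem lowerX11aFive_of_children_r16_three
    (h9 : thm61_splitMultiplicative ∧ thm61_nonsplitMultiplicative ∧
      (∀ (W : WeierstrassCurve ℚ) [W.IsElliptic] [W.IsGloballyMinimal] (p : ℕ) [Fact p.Prime],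
        p ≠ 2 → greenberg_stevens (W := W) (p := p)) ∧
      Kato2004.thm12_4 ∧ exists_isNewformOf ∧
      Kato2004.exists_multDivisibilityInputs_nonsplit_contra ∧
      Kato2004.exists_multDivisibilityInputs_split_contra ∧
      Kato2004.exists_multDivisibilityInputs_fine_contra ∧ mazur_not_dvd_maninConstant_of_odd)
    (h8L : thm311_cotorsion_weightK_member_ofLevel_odd ∧ thm1_muAlg_of_weightK_member_ofLevel_odd ∧
      Wan2015.thm4_rational_weightK_member_of_bdd_ofLevel_irred ∧
      thm513_transfer_from_weightK_member_of_bdd_ofLevel_odd ∧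
      DeligneSerre1974.thm61_exists_adicGaloisRep ∧ Hida2000_thm326_ordinary ∧
      kato_charIdeal_dvd_multiplicative_of_surjective ∧
      rank_eq_analyticRank_of_analyticRank_le_one)
    (hμ5 : ∀ (W : WeierstrassCurve ℚ) [W.IsElliptic] [W.IsGloballyMinimal] (p : ℕ) [Fact p.Prime],
      ClassX11a W p → 5 ≤ p → ¬ X11a.ShaAnUnit W p → X11a.MuAnZeroAt W p) :
    ∀ (W : WeierstrassCurve ℚ) [W.IsElliptic] [W.IsGloballyMinimal] (p : ℕ) [Fact p.Prime],
      ClassX11a W p → 5 ≤ p → MissingLowerBoundAt W p := by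
  obtain ⟨hJs, hJn, hGS, h12, hNf, hns', hsp', hfine', hMz⟩ := h9
  obtain ⟨h311, hT1a, hT2, hT1b, h61, h326, hKato, hGZK⟩ := h8L
  intro W _ _ p _ hX hp5
  by_cases hu : X11a.ShaAnUnit W p
  · exact x11a_missingLowerBoundAt_of_shaAnUnit hu
  -- deep pair at `p ≥ 5`: the certificate + Wan's member + the surjective / contra doors (verbatim p652061 §1)
  have hμ : X11a.MuAnZeroAt W p := hμ5 W p hX hp5 hu
  obtain ⟨M, _, hpM, k, g, ι, hmem, hRat⟩ := memberRatEqAt_of_wan_of_five_le W p hNf hT2 hp5 hX.mult hX.irr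
  by_cases hsurj : Surj W p
  · have hsurj' : ∀ n : ℕ, W.HasSurjectiveModNGaloisRep (p ^ n : ℕ) :=
      kato_charIdeal_dvd_multiplicative_of_surjective.surjective_pow_of_five_le W p hp5 hsurj
    exact hX.missingLowerBoundAt_of_member_of_ratEq_of_surjective_pow hNf h311 hT1a hT1b h61 h326 hKato hJs hJn hGZK
      (hGS W p hX.ne_two) hsurj' hμ hpM g ι hmem hRat
  · exact hX.missingLowerBoundAt_of_member_of_ratEq_of_not_surj_contra hNf h311 hT1a hT1b h61 h326 h12 hns' hsp' hfine' hMz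
      hJs hJn hGZK (hGS W p hX.ne_two) hsurj hμ hpM g ι hmem hRat

/-! ### §2 The fact-free split of crux L: `p ≥ 5` restriction + the deep `p = 3` lower half -/

/-- **Crux `X11aLowerHalf` BY NAME ⟸ its `p ≥ 5` restriction `h5` + the lower half at the deep `p = 3` X11a pairs `h3`** — fact-free:
pairs with `#Ш_an` a `p`-adic unit are free (`x11a_missingLowerBoundAt_of_shaAnUnit`), an X11a prime is odd (`ClassX11a.ne_two`) so
`p = 3 ∨ 5 ≤ p`.  Pure logic; CONDITIONAL on both displayed halves (each OPEN class-wide through its residual statement); closes nothing;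
BSD is not proved. [cite: Miller2011LMS, Def. 1.1 (arXiv:1010.2431 p. 3)] [cite: GreenbergLNM1716, §1 Conj. 1.11 (shape only)] -/
theorem x11aLowerHalf_of_lowerX11aFive_of_threeDeep
    (h5 : ∀ (W : WeierstrassCurve ℚ) [W.IsElliptic] [W.IsGloballyMinimal] (p : ℕ) [Fact p.Prime],
      ClassX11a W p → 5 ≤ p → MissingLowerBoundAt W p)
    (h3 : ∀ (W : WeierstrassCurve ℚ) [W.IsElliptic] [W.IsGloballyMinimal] (p : ℕ) [Fact p.Prime],
      ClassX11a W p → p = 3 → ¬ X11a.ShaAnUnit W p → MissingLowerBoundAt W p) :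
    Summit.BirchSwinnertonDyer.BirchSwinnertonDyer.Theses.PrintX11a.X11aLowerHalf := by
  intro W _ _ p hpF hX
  by_cases hu : X11a.ShaAnUnit W p
  · exact x11a_missingLowerBoundAt_of_shaAnUnit hu
  by_cases hp3 : p = 3
  · exact h3 W p hX hp3 hu
  · exact h5 W p hX ((Fact.out : p.Prime).five_le_of_ne_two_of_ne_three hX.ne_two hp3)

/-- The `ErratumRoadFive` spelling of the fact-free split (one statement under two route names, `Iff.rfl`). Pure logic; closes nothing.
[cite: Miller2011LMS, Def. 1.1 (arXiv:1010.2431 p. 3)] -/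
theorem x11aLowerHalf_erratumRoadFive_of_lowerX11aFive_of_threeDeep
    (h5 : ∀ (W : WeierstrassCurve ℚ) [W.IsElliptic] [W.IsGloballyMinimal] (p : ℕ) [Fact p.Prime],
      ClassX11a W p → 5 ≤ p → MissingLowerBoundAt W p)
    (h3 : ∀ (W : WeierstrassCurve ℚ) [W.IsElliptic] [W.IsGloballyMinimal] (p : ℕ) [Fact p.Prime],
      ClassX11a W p → p = 3 → ¬ X11a.ShaAnUnit W p → MissingLowerBoundAt W p) :
    Summit.BirchSwinnertonDyer.BirchSwinnertonDyer.Theses.ErratumRoadFive.X11aLowerHalf :=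
  x11aLowerHalf_of_lowerX11aFive_of_threeDeep h5 h3

/-! ### §3 Crux L BY NAME ⟸ its `p ≥ 5` restriction + r16's `p = 3` side -/

/-- **Crux `X11aLowerHalf` BY NAME ⟸ its `p ≥ 5` restriction `h5` + line r16's children as consumed at `p = 3`**: the shared nine `h9`
(all nine conjuncts are used at `3`), the eight chain facts `h8L` (only conjuncts 7–8, Kato–Wuthrich A32 and GZK, are used at `3`; bound whole
so that the binder is the registered text), the three partner facts `hQ3` (EPW Cor. 5.1.4, Yan–Zhu Thm. 4.9, EPW Thm. 1 alg — finite-flat `p = 3`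
pairs, through the Hesse-pencil partner) and `hMC3` (Mazur's cyclotomic main conjecture at the très-ramifié deep X11a pairs at `3`; OPEN) —
`p = 3` through p646859's `ThreePartner.lowerThreeDeep_of_partnerFF_of_mazurTR_of_facts` exactly as in r15 ∕ r16.  This is the composition of
crux L for a line whose `p ≥ 5` child is a by-name alias of the restriction (not filed today; the planners' call).  p652061's
`x11aLowerHalf_of_children_r16 h9 h8L hQ3 hμ5 hMC3` is this theorem at `h5 := lowerX11aFive_of_children_r16_three h9 h8L hμ5`.
CONDITIONAL; closes nothing; BSD is not proved.
[cite: MazurTateTeitelbaum1986Invent, §I.14 (shape only)] [cite: EmertonPollackWeston2006, Cor. 5.1.4, Thm. 1]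
[cite: YanZhu2024MainConjNonCM, Thm. 4.9] [cite: Fisher2012Hessian, Thm. 13.2 (n = 3)] [cite: Wuthrich2014, Lemma 20 (p. 400)]
[cite: Miller2011LMS, Def. 1.1 (arXiv:1010.2431 p. 3)] -/
theorem x11aLowerHalf_of_lowerX11aFive_of_children_r16
    (h5 : ∀ (W : WeierstrassCurve ℚ) [W.IsElliptic] [W.IsGloballyMinimal] (p : ℕ) [Fact p.Prime],
      ClassX11a W p → 5 ≤ p → MissingLowerBoundAt W p)
    (h9 : thm61_splitMultiplicative ∧ thm61_nonsplitMultiplicative ∧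
      (∀ (W : WeierstrassCurve ℚ) [W.IsElliptic] [W.IsGloballyMinimal] (p : ℕ) [Fact p.Prime],
        p ≠ 2 → greenberg_stevens (W := W) (p := p)) ∧
      Kato2004.thm12_4 ∧ exists_isNewformOf ∧
      Kato2004.exists_multDivisibilityInputs_nonsplit_contra ∧
      Kato2004.exists_multDivisibilityInputs_split_contra ∧
      Kato2004.exists_multDivisibilityInputs_fine_contra ∧ mazur_not_dvd_maninConstant_of_odd)
    (h8L : thm311_cotorsion_weightK_member_ofLevel_odd ∧ thm1_muAlg_of_weightK_member_ofLevel_odd ∧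
      Wan2015.thm4_rational_weightK_member_of_bdd_ofLevel_irred ∧
      thm513_transfer_from_weightK_member_of_bdd_ofLevel_odd ∧
      DeligneSerre1974.thm61_exists_adicGaloisRep ∧ Hida2000_thm326_ordinary ∧
      kato_charIdeal_dvd_multiplicative_of_surjective ∧
      rank_eq_analyticRank_of_analyticRank_le_one)
    (hQ3 : cor514_transfer_of_goodOrdinary_odd ∧ YanZhu2026.thm49_charIdeal_eq_padicLFunction ∧
      thm1_muAlg_transfer_goodOrdinary_of_mult_odd)
    (hMC3 : ∀ (W : WeierstrassCurve ℚ) [W.IsElliptic] [W.IsGloballyMinimal] (p : ℕ) [Fact p.Prime],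
      ClassX11a W p → p = 3 → ¬ X11a.ShaAnUnit W p → ¬ p ∣ padicValInt p W.minimalDiscriminantInt →
      X2.MazurMainConjectureAt W p) :
    Summit.BirchSwinnertonDyer.BirchSwinnertonDyer.Theses.PrintX11a.X11aLowerHalf := by
  obtain ⟨hJs, hJn, hGS, h12, hNf, hns', hsp', hfine', hMz⟩ := h9
  obtain ⟨hEPW, hYZ, hTa⟩ := hQ3
  exact x11aLowerHalf_of_lowerX11aFive_of_threeDeep h5
    (ThreePartner.lowerThreeDeep_of_partnerFF_of_mazurTR_of_facts hNf h8L.2.2.2.2.2.2.1 h12 hns' hsp' hfine' hMz hJs hJn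
      h8L.2.2.2.2.2.2.2 hGS hEPW hYZ hTa hMC3)

/-- The `ErratumRoadFive` spelling of §3 (one statement under two route names, `Iff.rfl`). CONDITIONAL; closes nothing; BSD is not proved.
[cite: Miller2011LMS, Def. 1.1 (arXiv:1010.2431 p. 3)] [cite: MazurTateTeitelbaum1986Invent, §I.14 (shape only)] -/
theorem x11aLowerHalf_erratumRoadFive_of_lowerX11aFive_of_children_r16
    (h5 : ∀ (W : WeierstrassCurve ℚ) [W.IsElliptic] [W.IsGloballyMinimal] (p : ℕ) [Fact p.Prime],
      ClassX11a W p → 5 ≤ p → MissingLowerBoundAt W p)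
    (h9 : thm61_splitMultiplicative ∧ thm61_nonsplitMultiplicative ∧
      (∀ (W : WeierstrassCurve ℚ) [W.IsElliptic] [W.IsGloballyMinimal] (p : ℕ) [Fact p.Prime],
        p ≠ 2 → greenberg_stevens (W := W) (p := p)) ∧
      Kato2004.thm12_4 ∧ exists_isNewformOf ∧
      Kato2004.exists_multDivisibilityInputs_nonsplit_contra ∧
      Kato2004.exists_multDivisibilityInputs_split_contra ∧
      Kato2004.exists_multDivisibilityInputs_fine_contra ∧ mazur_not_dvd_maninConstant_of_odd)
    (h8L : thm311_cotorsion_weightK_member_ofLevel_odd ∧ thm1_muAlg_of_weightK_member_ofLevel_odd ∧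
      Wan2015.thm4_rational_weightK_member_of_bdd_ofLevel_irred ∧
      thm513_transfer_from_weightK_member_of_bdd_ofLevel_odd ∧
      DeligneSerre1974.thm61_exists_adicGaloisRep ∧ Hida2000_thm326_ordinary ∧
      kato_charIdeal_dvd_multiplicative_of_surjective ∧
      rank_eq_analyticRank_of_analyticRank_le_one)
    (hQ3 : cor514_transfer_of_goodOrdinary_odd ∧ YanZhu2026.thm49_charIdeal_eq_padicLFunction ∧
      thm1_muAlg_transfer_goodOrdinary_of_mult_odd)
    (hMC3 : ∀ (W : WeierstrassCurve ℚ) [W.IsElliptic] [W.IsGloballyMinimal] (p : ℕ) [Fact p.Prime],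
      ClassX11a W p → p = 3 → ¬ X11a.ShaAnUnit W p → ¬ p ∣ padicValInt p W.minimalDiscriminantInt →
      X2.MazurMainConjectureAt W p) :
    Summit.BirchSwinnertonDyer.BirchSwinnertonDyer.Theses.ErratumRoadFive.X11aLowerHalf :=
  x11aLowerHalf_of_lowerX11aFive_of_children_r16 h5 h9 h8L hQ3 hMC3

/-! ### §4 The same restriction on the lead's candidate r17 («the `p ≥ 5` child in MAZUR currency», p656106) -/

/-- **The `p ≥ 5` restriction of crux `X11aLowerHalf` from Mazur's statement at the deep X11a pairs with `p ≥ 5` and FIVE named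
facts** — the minimal display: modularity `hNf`, Stein–Wuthrich 6.1 split ∕ non-split `hJs` ∕ `hJn`, GZK `hGZK`, Greenberg–Stevens at odd `p`
`hGS`, and `hMC5 : ∀ W p, ClassX11a W p → 5 ≤ p → ¬ X11a.ShaAnUnit W p → X2.MazurMainConjectureAt W p` (= the lead's candidate r17 text
`stub_mazurMCAtDeepFive` verbatim: Mazur's cyclotomic main conjecture at `(E, p)` for every deep X11a pair with `p ≥ 5`, both images; OPEN
class-wide — printed only under (ram), Skinner 2016 Thm. A).  Unit pairs free; deep pairs through p646859's five-fact door
`ClassX11a.missingLowerBoundAt_of_mazurMainConjectureAt_of_facts` (stated for any X11a pair).  So a consumer of this restriction (bsd-stepL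
crux 19715) meets the x11a cell in ONE research statement + five printed facts.  CONDITIONAL; closes nothing; BSD is not proved.
[cite: Skinner2016PacificMC, Thm. A (shape only; printed under (ram))] [cite: SteinWuthrich2013, Thm. 6.1]
[cite: MazurTateTeitelbaum1986Invent, §I.14 (shape only)] [cite: Miller2011LMS, Def. 1.1 (arXiv:1010.2431 p. 3)] -/
theorem lowerX11aFive_of_mazurMCAtDeepFive_of_fiveFacts
    (hNf : exists_isNewformOf) (hJs : thm61_splitMultiplicative) (hJn : thm61_nonsplitMultiplicative)
    (hGZK : rank_eq_analyticRank_of_analyticRank_le_one)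
    (hGS : ∀ (W : WeierstrassCurve ℚ) [W.IsElliptic] [W.IsGloballyMinimal] (p : ℕ) [Fact p.Prime],
      p ≠ 2 → greenberg_stevens (W := W) (p := p))
    (hMC5 : ∀ (W : WeierstrassCurve ℚ) [W.IsElliptic] [W.IsGloballyMinimal] (p : ℕ) [Fact p.Prime],
      ClassX11a W p → 5 ≤ p → ¬ X11a.ShaAnUnit W p → X2.MazurMainConjectureAt W p) :
    ∀ (W : WeierstrassCurve ℚ) [W.IsElliptic] [W.IsGloballyMinimal] (p : ℕ) [Fact p.Prime],
      ClassX11a W p → 5 ≤ p → MissingLowerBoundAt W p := by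
  intro W _ _ p _ hX hp5
  by_cases hu : X11a.ShaAnUnit W p
  · exact x11a_missingLowerBoundAt_of_shaAnUnit hu
  · exact hX.missingLowerBoundAt_of_mazurMainConjectureAt_of_facts hNf hJs hJn hGZK (hGS W p hX.ne_two)
      (hMC5 W p hX hp5 hu)

/-- **The `p ≥ 5` restriction of crux `X11aLowerHalf` from THREE of candidate r17's five children** (lead x11a-p1 g7, p656106,
announced 2026-08-28T18:08:35Z): the shared nine `h9` (= `stub_nineFactsOddGS`; only modularity, Stein–Wuthrich ×2 and Greenberg–Stevens are
consumed here), the two-fact child `h2L` (= `stub_katoGZKFactsLower`: Kato–Wuthrich A32 ∧ GZK; only GZK is consumed here) and the Mazur child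
`hMC5` (= `stub_mazurMCAtDeepFive`; OPEN) — binders byte-equal to the candidate texts; := `lowerX11aFive_of_mazurMCAtDeepFive_of_fiveFacts`
after projection.  As in §1, the two `p = 3` children are not binders.  CONDITIONAL; closes nothing; BSD is not proved.
[cite: Skinner2016PacificMC, Thm. A (shape only; printed under (ram))] [cite: SteinWuthrich2013, Thm. 6.1]
[cite: Miller2011LMS, Def. 1.1 (arXiv:1010.2431 p. 3)] -/
theorem lowerX11aFive_of_children_r17_three
    (h9 : thm61_splitMultiplicative ∧ thm61_nonsplitMultiplicative ∧
      (∀ (W : WeierstrassCurve ℚ) [W.IsElliptic] [W.IsGloballyMinimal] (p : ℕ) [Fact p.Prime],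
        p ≠ 2 → greenberg_stevens (W := W) (p := p)) ∧
      Kato2004.thm12_4 ∧ exists_isNewformOf ∧
      Kato2004.exists_multDivisibilityInputs_nonsplit_contra ∧
      Kato2004.exists_multDivisibilityInputs_split_contra ∧
      Kato2004.exists_multDivisibilityInputs_fine_contra ∧ mazur_not_dvd_maninConstant_of_odd)
    (h2L : kato_charIdeal_dvd_multiplicative_of_surjective ∧ rank_eq_analyticRank_of_analyticRank_le_one)
    (hMC5 : ∀ (W : WeierstrassCurve ℚ) [W.IsElliptic] [W.IsGloballyMinimal] (p : ℕ) [Fact p.Prime],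
      ClassX11a W p → 5 ≤ p → ¬ X11a.ShaAnUnit W p → X2.MazurMainConjectureAt W p) :
    ∀ (W : WeierstrassCurve ℚ) [W.IsElliptic] [W.IsGloballyMinimal] (p : ℕ) [Fact p.Prime],
      ClassX11a W p → 5 ≤ p → MissingLowerBoundAt W p :=
  lowerX11aFive_of_mazurMCAtDeepFive_of_fiveFacts h9.2.2.2.2.1 h9.1 h9.2.1 h2L.2 h9.2.2.1 hMC5

/-- **Crux `X11aLowerHalf` BY NAME ⟸ its `p ≥ 5` restriction `h5` + candidate r17's children as consumed at `p = 3`**: the shared nine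
`h9` (all nine used at `3`), the two-fact child `h2L` (Kato–Wuthrich A32 ∧ GZK, both used at `3`), the three partner facts `hQ3` and `hMC3`
— `p = 3` through p646859's `ThreePartner.lowerThreeDeep_of_partnerFF_of_mazurTR_of_facts` exactly as in r15 ∕ r16 ∕ r17.  The lead's
`x11aLowerHalf_of_children_r17 h9 h2L hQ3 hMC5 hMC3` (p656106) is this theorem at `h5 := lowerX11aFive_of_children_r17_three h9 h2L hMC5`.
CONDITIONAL; closes nothing; BSD is not proved.
[cite: MazurTateTeitelbaum1986Invent, §I.14 (shape only)] [cite: EmertonPollackWeston2006, Cor. 5.1.4, Thm. 1]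
[cite: YanZhu2024MainConjNonCM, Thm. 4.9] [cite: Fisher2012Hessian, Thm. 13.2 (n = 3)] [cite: Wuthrich2014, Lemma 20 (p. 400)]
[cite: Miller2011LMS, Def. 1.1 (arXiv:1010.2431 p. 3)] -/
theorem x11aLowerHalf_of_lowerX11aFive_of_children_r17
    (h5 : ∀ (W : WeierstrassCurve ℚ) [W.IsElliptic] [W.IsGloballyMinimal] (p : ℕ) [Fact p.Prime],
      ClassX11a W p → 5 ≤ p → MissingLowerBoundAt W p)
    (h9 : thm61_splitMultiplicative ∧ thm61_nonsplitMultiplicative ∧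
      (∀ (W : WeierstrassCurve ℚ) [W.IsElliptic] [W.IsGloballyMinimal] (p : ℕ) [Fact p.Prime],
        p ≠ 2 → greenberg_stevens (W := W) (p := p)) ∧
      Kato2004.thm12_4 ∧ exists_isNewformOf ∧
      Kato2004.exists_multDivisibilityInputs_nonsplit_contra ∧
      Kato2004.exists_multDivisibilityInputs_split_contra ∧
      Kato2004.exists_multDivisibilityInputs_fine_contra ∧ mazur_not_dvd_maninConstant_of_odd)
    (h2L : kato_charIdeal_dvd_multiplicative_of_surjective ∧ rank_eq_analyticRank_of_analyticRank_le_one)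
    (hQ3 : cor514_transfer_of_goodOrdinary_odd ∧ YanZhu2026.thm49_charIdeal_eq_padicLFunction ∧
      thm1_muAlg_transfer_goodOrdinary_of_mult_odd)
    (hMC3 : ∀ (W : WeierstrassCurve ℚ) [W.IsElliptic] [W.IsGloballyMinimal] (p : ℕ) [Fact p.Prime],
      ClassX11a W p → p = 3 → ¬ X11a.ShaAnUnit W p → ¬ p ∣ padicValInt p W.minimalDiscriminantInt →
      X2.MazurMainConjectureAt W p) :
    Summit.BirchSwinnertonDyer.BirchSwinnertonDyer.Theses.PrintX11a.X11aLowerHalf := by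
  obtain ⟨hJs, hJn, hGS, h12, hNf, hns', hsp', hfine', hMz⟩ := h9
  obtain ⟨hKato, hGZK⟩ := h2L
  obtain ⟨hEPW, hYZ, hTa⟩ := hQ3
  exact x11aLowerHalf_of_lowerX11aFive_of_threeDeep h5
    (ThreePartner.lowerThreeDeep_of_partnerFF_of_mazurTR_of_facts hNf hKato h12 hns' hsp' hfine' hMz hJs hJn hGZK hGS
      hEPW hYZ hTa hMC3)

/-- The `ErratumRoadFive` spelling of the r17-side composition (one statement under two route names, `Iff.rfl`). CONDITIONAL; closes
nothing; BSD is not proved. [cite: Miller2011LMS, Def. 1.1 (arXiv:1010.2431 p. 3)] [cite: MazurTateTeitelbaum1986Invent, §I.14 (shape only)] -/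
theorem x11aLowerHalf_erratumRoadFive_of_lowerX11aFive_of_children_r17
    (h5 : ∀ (W : WeierstrassCurve ℚ) [W.IsElliptic] [W.IsGloballyMinimal] (p : ℕ) [Fact p.Prime],
      ClassX11a W p → 5 ≤ p → MissingLowerBoundAt W p)
    (h9 : thm61_splitMultiplicative ∧ thm61_nonsplitMultiplicative ∧
      (∀ (W : WeierstrassCurve ℚ) [W.IsElliptic] [W.IsGloballyMinimal] (p : ℕ) [Fact p.Prime],
        p ≠ 2 → greenberg_stevens (W := W) (p := p)) ∧
      Kato2004.thm12_4 ∧ exists_isNewformOf ∧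
      Kato2004.exists_multDivisibilityInputs_nonsplit_contra ∧
      Kato2004.exists_multDivisibilityInputs_split_contra ∧
      Kato2004.exists_multDivisibilityInputs_fine_contra ∧ mazur_not_dvd_maninConstant_of_odd)
    (h2L : kato_charIdeal_dvd_multiplicative_of_surjective ∧ rank_eq_analyticRank_of_analyticRank_le_one)
    (hQ3 : cor514_transfer_of_goodOrdinary_odd ∧ YanZhu2026.thm49_charIdeal_eq_padicLFunction ∧
      thm1_muAlg_transfer_goodOrdinary_of_mult_odd)
    (hMC3 : ∀ (W : WeierstrassCurve ℚ) [W.IsElliptic] [W.IsGloballyMinimal] (p : ℕ) [Fact p.Prime],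
      ClassX11a W p → p = 3 → ¬ X11a.ShaAnUnit W p → ¬ p ∣ padicValInt p W.minimalDiscriminantInt →
      X2.MazurMainConjectureAt W p) :
    Summit.BirchSwinnertonDyer.BirchSwinnertonDyer.Theses.ErratumRoadFive.X11aLowerHalf :=
  x11aLowerHalf_of_lowerX11aFive_of_children_r17 h5 h9 h2L hQ3 hMC3

end Summit.BirchSwinnertonDyer.BirchSwinnertonDyer.Theorems.Birth

end
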